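import Mathlib
import Literature.MathematicalPhysics.QuantumFieldTheory.Balaban1983to89.B13Lemma3TorusData
import Literature.MathematicalPhysics.QuantumFieldTheory.Balaban1983to89.B13Ineq232Torus
import Literature.MathematicalPhysics.QuantumFieldTheory.Balaban1983to89.TreeLengthTorusGeometry236Printed

/-!
# `Balaban1983to89.B13Lemma3Torus` — T. Bałaban, *Renormalization group approach to lattice gauge field theories.
II. Cluster expansions*, Commun. Math. Phys. **116** (1988) 1–22 [Balaban1988RG2Cluster]: the resummation pp. 17–20
proving Lemma 3 (2.38) — `B13Lemma3Assembly.bound238With_of_226` — with EVERY geometric and combinatorial input of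
the four pages DISCHARGED ON THE PAPERS' PERIODIC CARRIER (two nested tori: 𝐃_k := `TreeLengthTorus.tsys d (L·N′)`,
𝐃_{k+1} := `tsys d N′` of the SAME torus, d_j := `torusTreeLen`, closure map Z ↦ Z′ := `tclosureDom L N′`), so that
(2.38) AS PRINTED follows ON THE TORUS from the analytic input (2.26) in its resummed form and the printed restrictions
on the constants alone; and §2 of the paper END TO END on the torus (→ `TreeLengthTorusGeometry.deliverables_torus`)

statement-level skeleton of published theorems with citation tags; proofs where landed; nothing here is a claim about
the Yang–Mills mass gap

PDF held: `paper:balaban1988-cmp116-rg-ii-cluster` (journal page = PDF page + 0); pp. 17–20 re-read this session from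
the text layer `p0017.txt`–`p0020.txt` of that key (displays (2.26)–(2.38) are quoted verbatim in
`…B13Lemma3Assembly`, `…B13`, `…B13Step237`; the sentences used by THIS module are quoted below).

CITATION HEADER / WHAT IS REPRODUCED (unit `lit-balaban-r10` gen 10, B13 fold owner; SKELETON rows `B13.Lem3`,
`B13.Eq2.38`, `B13.Eq2.37`, `B13.Eq2.35`, `B13.Eq2.32`, `B13.Main` of `HOME/lit-balaban-r10/ROWS-B13.md`, HOME =
`run/shared/lean/pub/lit-balaban/`; kind «model-instance on the torus»).  The window instance is
`B13Lemma3Window.bound238With_window` (gen 6; free-boundary window of ℤ⁴ — cell DIVERGENCE: the papers' cubes live on a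
torus, [Balaban1987RG1] p. 251: *"a torus T obtained by the usual identification of boundary points of the cube"*).
HERE, on the torus:
* §1 the scale-(k+1) index data: the admissible Z′₀ of p. 20 *"The last sum to estimate is the sum over Z′₀, or over
  Z∖Z′₀"* over-counted by ALL non-empty Z′₀ ⊆ Z (`J Z`; p. 14: *"each connected component of Z contains a component
  of Z′₀"*, so Z′₀ ≠ ∅), their TORUS components (`I Z j` := members of `B13Ineq232Torus.tcomps`, each a torus
  localization domain: `isTDom_I`), complements `wZ` (injective), (2.27) per component
  (`TreeLengthTorusGeometry.ineq227_tcubes`), *"(2.32), properly adapted to the new situation"* (p. 20) with the torus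
  kernel constant 2 + 4d (`B13Ineq232Torus.ineq232_torus`; d = 4: 18 = `B13.Consts.R16repaired`'s constant);
* §2 the combined (2.27) + (2.32) at scale k (the hypothesis `h2732`) from the torus components of Y₀
  (`B13Lemma3Assembly.combined_of_227_232`);
* §3 step data over TWO NESTED TORI (`TwoTorusStep d L N′`; `toTorusStep` = the one-torus carrier
  `TreeLengthTorusGeometry.TorusStep` of the torus closing step, `toStepData`);
* §4 **`bound238With_torus`**: for two-torus step data (d = 4, L = `c.L`), IF the activity is bounded on the space of
  p. 15 by the (2.26)-weights summed in the printed order over the CONCRETE torus index sets (`hrep`; the analytic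
  content (2.15)–(2.26) being by assertion in print) THEN `B13.Bound238With W.toStepData c ℓ` for every transfer factor
  ℓ ≥ 0 with (2.36)_ℓ, given the printed restrictions on the constants; `bound238_torus` — at the PRINTED ℓ = ½L, L ≥ 8,
  (2.36) being the THEOREM `TreeLengthTorusGeometry236Printed.ineq236Printed_torus`: **(2.38) AS PRINTED ON THE TORUS**,
  hence `lemma3Printed_torus`; `bound238With_torus_centre` at the kernel-certified ℓ = L / a236c(L), L ≥ 3;
* §5 **§2 END TO END ON THE TORUS** (`deliverables_torus_of_226`, `deliverables_torus_centre_of_226`): `hrep` + the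
  representation (2.13) + the restriction property of the spaces + the UNPRINTED log Z^{(k)} leaf + (I.1.7) /
  analyticity / gauge invariance + numbers ⇒ `B13.Deliverables W.toStepData c` — Lemma 3 from §4 fed into
  `TreeLengthTorusGeometry.deliverables_torus(_four)` (the [26]-step by the PROVED Kotecký–Preiss engine).
Discharged inside (hypotheses of `bound238With_of_226`): `hne`, `htouch`, `havail`, `h229`, `h2732`, `h230`, `hvol`,
`hanch`, `hLfac`, `h126`, `hcc`, `h227'`, `h229'`, `h232`, `hvol1`, `hw`, `hws` — from `…B13Lemma3TorusData`
(scale-k shapes, bond layer, anchors), `…B13Ineq232Torus` (components, (2.32)) and the torus theorems of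
`…TreeLengthTorus*`.  No `sorry`, no new named fact (D-0026); Mathlib + the three imported modules only.

HONEST SCOPE.  (i) The analytic content of Lemma 3 — (2.15)–(2.26) — and the fact that the terms of H(Z) ARE indexed
by (𝐃, P, Z₀) with Z′₀ ⊂ Z as on pp. 12–14 stay the hypothesis `hrep` (by assertion in print; over-counting of the
index sets only weakens it); for the typed generic term the chain (2.14) → (2.26) is kernel-checked elsewhere
(`B13Bound226Assembly`, window shapes).  (ii) The carrier IS the periodic one: π_k = the torus with L·N′ cubes of side
M per direction, π_{k+1} = its N′ blocks per direction ([Balaban1987RG1] p. 251, L ∣ N built in), d = 4; the unit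
torus T₁^{(k)} of the bond layer has M·L·N′ sites per direction.  (iii) Constants are the tree's honest ones wherever
print's are refuted or unspecified: c₃₂ = 18 at both scales (print 4; window 17), volume constant 64 in the additive
law, M4 = 8M⁴ (print 4M⁴), K₁ = K₀(64, 8) and κ₀ = 64 log 162, (L+2)⁴ as printed; the located slips of print are carried
exactly as in `B13Lemma3Assembly` (HONEST SCOPE there).  (iv) The block size of the geometry IS `c.L` (hypothesis
`c.L = L`: the (L+2)⁴ of the anchors meets the (L+2)⁴ of `B13Step237.memberF`).  Value = kernel-checked bookkeeping:
after this module the TORUS-model Lemma 3 — and with §5 the whole of §2 on the torus — rests on (2.26), the located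
leaf hypotheses and numbers only (closes item (3) of the r10 gen-9 HANDOFF; the window/torus DIVERGENCE of the Lemma-3
instance is gone).
-/

noncomputable section

namespace Literature.MathematicalPhysics.QuantumFieldTheory.Balaban1983to89.B13Lemma3Torus

open Literature.MathematicalPhysics.QuantumFieldTheory.Balaban1983to89
open Literature.MathematicalPhysics.QuantumFieldTheory.Balaban1983to89.TreeLengthTorus
open Literature.MathematicalPhysics.QuantumFieldTheory.Balaban1983to89.TreeLengthTorusGeometry
  (ineq227_tcubes TTouch TorusStep deliverables_torus deliverables_torus_four)
open Literature.MathematicalPhysics.QuantumFieldTheory.Balaban1983to89.TreeLengthTorusTransfer (tclosureDom)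
open Literature.MathematicalPhysics.QuantumFieldTheory.Balaban1983to89.TreeLengthTorusGeometry236Printed
  (ineq236Printed_torus ineq236With_torus_centre)
open Literature.MathematicalPhysics.QuantumFieldTheory.Balaban1983to89.B12TreeDecay (kappa₀ K₀ K₀_pos)
open Literature.MathematicalPhysics.QuantumFieldTheory.Balaban1983to89.B13Geometry236Printed (a236c a236c_pos)
open Literature.MathematicalPhysics.QuantumFieldTheory.Balaban1983to89.B13Ineq232Torus
open Literature.MathematicalPhysics.QuantumFieldTheory.Balaban1983to89.B13Lemma3TorusData
open Literature.MathematicalPhysics.QuantumFieldTheory.Balaban1983to89.B13Lemma3Assembly (innerSum compSum famSum)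
open Literature.MathematicalPhysics.QuantumFieldTheory.Balaban1983to89.B13Resummation (locE)

variable {d : ℕ}

/-! ## §1. Scale-(k+1) index data on the torus: the admissible Z′₀ ⊆ Z, their components Z′_i, the complements -/

section IndexData

variable {N' : ℕ} [NeZero N']

/-- The admissible Z′₀ of a localization domain Z ∈ 𝐃_{k+1} OF THE TORUS, over-counted by all non-empty families
Z′₀ ⊆ Z of LM-cubes — p. 20 *"The last sum to estimate is the sum over Z′₀, or over Z∖Z′₀"*; p. 14 *"The sums are
over Z such, that each connected component of Z contains a component of Z′₀"* (so Z′₀ ∩ Z ≠ ∅ for the terms of H(Z),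
(2.9)).  The index type `J Z` of `B13Bound238Assembly` / `bound238With_of_226`; window version `B13Lemma3Window.J`.
[cite: Balaban1988RG2Cluster, (2.9) p.14 and p.20 (the sum over Z′₀)] -/
def J (Z : TDom d N') : Type := {Z₀' : Finset (TPt d N') // Z₀' ⊆ Z.1 ∧ Z₀'.Nonempty}

/-- The admissible Z′₀ form a finite type. [folklore] -/
instance instFintypeJ (Z : TDom d N') : Fintype (J Z) :=
  Fintype.subtype (Z.1.powerset.filter fun Z₀' => Z₀'.Nonempty) fun Z₀' => by
    simp only [Finset.mem_filter, Finset.mem_powerset]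

/-- The connected components Z′_i of Z′₀ ON THE TORUS (p. 20: *"where now Z′_i denote connected components of Z′₀"*;
p. 19: *"the set Z′₀ is a union of connected components, which are localization domains from 𝐃_{k+1}"*), as the
finite type of the members of `B13Ineq232Torus.tcomps Z′₀` — the index type `I Z j`; window version
`B13Lemma3Window.I`. [cite: Balaban1988RG2Cluster, p.19–20 (components of Z′₀)] -/
def I (Z : TDom d N') (j : J Z) : Type := {K : Finset (TPt d N') // K ∈ tcomps j.1}

/-- The components form a finite type. [folklore] -/
instance instFintypeI (Z : TDom d N') (j : J Z) : Fintype (I Z j) :=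
  Fintype.subtype (tcomps j.1) fun _ => Iff.rfl

/-- A non-empty Z′₀ has at least one component (the component of any of its cubes). [folklore] -/
instance instNonemptyI (Z : TDom d N') (j : J Z) : Nonempty (I Z j) := by
  obtain ⟨a, ha⟩ := j.2.2
  exact ⟨⟨tcomp j.1 a, mem_tcomps.2 ⟨a, ha, rfl⟩⟩⟩

/-- Each component Z′_i is a localization domain of the coarse torus (p. 19: *"which are localization domains from
𝐃_{k+1}"*; `B13Ineq232Torus.isTDom_of_mem_tcomps`). [cite: Balaban1988RG2Cluster, p.19 (components are localization domains)] -/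
theorem isTDom_I (Z : TDom d N') (j : J Z) (i : I Z j) : IsTDom i.1 := isTDom_of_mem_tcomps i.2

/-- d_{k+1}(Z′_i) := `torusTreeLen` of the component (the `dI` of `B13Bound238Assembly`). [cite: Balaban1988RG2Cluster, (2.37) p.20] -/
def dI (Z : TDom d N') (j : J Z) (i : I Z j) : ℝ := torusTreeLen i.1

/-- The LM-cubes of the component Z′_i (the `cc` of `bound238With_of_226`; on the torus the cubes ARE the members).
[cite: Balaban1988RG2Cluster, (2.37) p.20] -/
def cc (Z : TDom d N') (j : J Z) (i : I Z j) : Finset (TPt d N') := i.1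

/-- The LM-cubes of Z∖Z′₀ (p. 20: *"the sum over Z′₀, or over Z∖Z′₀"*; their number is the printed (LM)⁻⁴|Z∖Z′₀| of
(2.26)/(2.35)/(2.37)) — the `w` of `B13Bound238Assembly`. [cite: Balaban1988RG2Cluster, p.20 (the sum over Z∖Z′₀)] -/
def wZ (Z : TDom d N') (j : J Z) : Finset (TPt d N') := Z.1 \ j.1

/-- Z′₀ ⊆ Z is determined by Z∖Z′₀ — p. 20: *"the sum over Z′₀, or over Z∖Z′₀"* — i.e. `wZ Z` is injective (the
hypothesis `hw` of `bound238With_of_226`). [cite: Balaban1988RG2Cluster, p.20 (the sum over Z∖Z′₀)] -/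
theorem wZ_injective (Z : TDom d N') : Function.Injective (wZ Z) := by
  intro j j' h
  apply Subtype.ext
  have hj : j.1 = Z.1 \ (Z.1 \ j.1) := (Finset.sdiff_sdiff_eq_self j.2.1).symm
  have hj' : j'.1 = Z.1 \ (Z.1 \ j'.1) := (Finset.sdiff_sdiff_eq_self j'.2.1).symm
  rw [hj, hj']
  show Z.1 \ wZ Z j = Z.1 \ wZ Z j'
  rw [h]

/-- The cubes of Z∖Z′₀ are cubes of Z (the hypothesis `hws`). [cite: Balaban1988RG2Cluster, p.20 (the sum over Z∖Z′₀)] -/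
theorem wZ_subset (Z : TDom d N') (j : J Z) : wZ Z j ⊆ Z.1 := Finset.sdiff_subset

/-- The components Z′_i are non-empty families of LM-cubes (the hypothesis `hcc`). [cite: Balaban1988RG2Cluster, p.19 (components are localization domains)] -/
theorem cc_nonempty (Z : TDom d N') (j : J Z) (i : I Z j) : (cc Z j i).Nonempty := (isTDom_I Z j i).1

/-- **(2.27) at scale k + 1 for each component Z′_i ON THE TORUS** (p. 20: *"The inequality (2.27) is used for the
remaining exponential factors"*): for every family of 𝐃_{k+1}-domains whose cubes cover exactly Z′_i, d_{k+1}(Z′_i) +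
5 ≤ Σ (d_{k+1}(Z′) + 5) — `TreeLengthTorusGeometry.ineq227_tcubes`, the hypothesis `h227'`. [cite: Balaban1988RG2Cluster, (2.27) p.18 (used at scale k+1, p.20)] -/
theorem h227'_torus (Z : TDom d N') (j : J Z) (i : I Z j) :
    B13FamilySum.Ineq227 (Finset.univ : Finset (TDom d N')) (fun Y : TDom d N' => Y.1) (tsys d N').dj (cc Z j i)
      (dI Z j i) 5 :=
  ineq227_tcubes d N' ⟨i.1, isTDom_I Z j i⟩

/-- **(2.32) "properly adapted to the new situation" ON THE TORUS** (p. 20, verbatim: *"Using the inequality (2.32),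
properly adapted to the new situation, we bound the exponential factors in the square bracket above, and half of the
first exponential factor, by exp(−(1 − 7δ)½Lκd_{k+1}(Z))"*) — at scale k + 1, for the connected Z ⊇ Z′₀ ≠ ∅ with the
torus components Z′_i of Z′₀: d_{k+1}(Z) ≤ Σ_i d_{k+1}(Z′_i) + (2 + 4d)·(LM)⁻⁴|Z∖Z′₀| (`B13Ineq232Torus.ineq232_torus`)
— the hypothesis `h232`. [cite: Balaban1988RG2Cluster, (2.32) p.18 (adapted at scale k+1, p.20)] -/
theorem h232_torus (Z : TDom d N') (j : J Z) :
    torusTreeLen Z.1 ≤ ∑ i : I Z j, dI Z j i + (2 + 4 * (d : ℝ)) * ((wZ Z j).card : ℝ) := by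
  have h := ineq232_torus Z.2.2 j.2.1 j.2.2
  have hsum : ∑ K ∈ tcomps j.1, torusTreeLen K = ∑ i : I Z j, dI Z j i := by
    rw [← Finset.sum_coe_sort]
    rfl
  rw [hsum] at h
  exact h

/-- d = 4: d_{k+1}(Z) ≤ Σ_i d_{k+1}(Z′_i) + 18·(LM)⁻⁴|Z∖Z′₀| (torus kernel constant 18 for the printed 4).
[cite: Balaban1988RG2Cluster, (2.32) p.18 (adapted at scale k+1, p.20)] -/
theorem h232_torus_four {N' : ℕ} [NeZero N'] (Z : TDom 4 N') (j : J Z) :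
    torusTreeLen Z.1 ≤ ∑ i : I Z j, dI Z j i + 18 * ((wZ Z j).card : ℝ) := by
  have h := h232_torus Z j
  norm_num at h
  exact h

end IndexData

/-! ## §2. The combined (2.27) + (2.32) at scale k on the torus (hypothesis `h2732`) -/

section Combined

variable {N : ℕ} [NeZero N]

/-- **The hypothesis `h2732` of `B13Lemma3Assembly.bound238With_of_226` ON THE TORUS** (`S.Dk := tsys d N`, cubes :=
the members, c₃₂ = 2 + 4d): for every torus localization domain Z₀ (a connected component of the set Z₀, p. 18), every
Y₀ ⊆ Z₀ and every NON-EMPTY family 𝐃 of torus localization domains whose cubes cover exactly Y₀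
(`B13FamilySum.coveringFamilies`), `d_k(Z₀) + 5 ≤ Σ_{Y∈𝐃}(d_k(Y) + 5) + (2 + 4d)·|Z₀∖Y₀|` — (2.27) for the torus
components of Y₀ (`TreeLengthTorusGeometry.ineq227_tcubes`; p. 17 *"𝐃 = ∪_i 𝐃_i, 𝐃_i satisfy ∪_{Y∈𝐃_i} Y = Y_i"* via
`B13Ineq232Torus.subset_tcomp_of_tFaceConnected`) combined with (2.32) on the torus (`B13Ineq232Torus.ineq232_torus`)
through `B13Lemma3Assembly.combined_of_227_232`.  Window version `B13Lemma3AssemblyWindow.h2732_window_general`.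
[cite: Balaban1988RG2Cluster, (2.27) and (2.32) p.18] -/
theorem h2732_torus (Zc : TDom d N) (Y₀ : Finset (TPt d N)) (hY₀ : Y₀ ⊆ Zc.1) (D : Finset (TDom d N))
    (hD : D ∈ B13FamilySum.coveringFamilies (Finset.univ : Finset (TDom d N)) (fun Y : TDom d N => Y.1) Y₀)
    (hDne : D.Nonempty) :
    torusTreeLen Zc.1 + 5 ≤ ∑ Y ∈ D, (torusTreeLen Y.1 + 5) + (2 + 4 * (d : ℝ)) * ((Zc.1 \ Y₀).card : ℝ) := by
  classical
  obtain ⟨-, hU⟩ := B13FamilySum.mem_coveringFamilies.1 hD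
  have hY₀ne : Y₀.Nonempty := by
    obtain ⟨Y, hY⟩ := hDne
    obtain ⟨x, hx⟩ := Y.2.1
    refine ⟨x, ?_⟩
    rw [← hU]
    exact Finset.mem_biUnion.2 ⟨Y, hY, hx⟩
  refine B13Lemma3Assembly.combined_of_227_232 (Finset.univ : Finset (TDom d N)) (fun Y : TDom d N => Y.1)
    (tsys d N).dj Y₀ (tcomps Y₀) (fun p => torusTreeLen p) (dZ := torusTreeLen Zc.1) (c₃₂ := 2 + 4 * (d : ℝ))
    (N' := ((Zc.1 \ Y₀).card : ℝ)) (fun Y _ => Y.2.1) (fun Y _ => torusTreeLen_nonneg Y.1) (tcomps_nonempty hY₀ne)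
    (fun p hp => (subset_of_mem_tcomps hp).1) (fun p hp q hq hpq => tcomps_disjoint hp hq hpq) ?_ ?_ ?_ D hD
  · -- a connected member inside Y₀ lies inside one component
    intro Y _ hYY₀
    obtain ⟨a, ha⟩ := Y.2.1
    exact ⟨tcomp Y₀ a, mem_tcomps.2 ⟨a, hYY₀ ha, rfl⟩, subset_tcomp_of_tFaceConnected Y.2.2 hYY₀ ha⟩
  · -- (2.27) per component
    intro p hp
    exact h227_torus ⟨p, isTDom_of_mem_tcomps hp⟩
  · -- (2.32) on the torus
    exact ineq232_torus Zc.2.2 hY₀ hY₀ne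

/-- d = 4: `d_k(Z₀) + 5 ≤ Σ_{Y∈𝐃}(d_k(Y) + 5) + 18·|Z₀∖Y₀|` — the torus twin of `B13Lemma3AssemblyWindow.h2732_window`
(window constant 17). [cite: Balaban1988RG2Cluster, (2.27) and (2.32) p.18] -/
theorem h2732_torus_four {N : ℕ} [NeZero N] (Zc : TDom 4 N) (Y₀ : Finset (TPt 4 N)) (hY₀ : Y₀ ⊆ Zc.1)
    (D : Finset (TDom 4 N))
    (hD : D ∈ B13FamilySum.coveringFamilies (Finset.univ : Finset (TDom 4 N)) (fun Y : TDom 4 N => Y.1) Y₀)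
    (hDne : D.Nonempty) :
    torusTreeLen Zc.1 + 5 ≤ ∑ Y ∈ D, (torusTreeLen Y.1 + 5) + 18 * ((Zc.1 \ Y₀).card : ℝ) := by
  have h := h2732_torus Zc Y₀ hY₀ D hD hDne
  norm_num at h
  exact h

end Combined

/-! ## §3. Step data over two nested tori -/

/-- STEP DATA OVER TWO NESTED TORI: the carrier `B13.StepData` with BOTH systems of localization domains fixed to be the
periodic systems of the papers on the SAME torus of [Balaban1987RG1] p. 251 — 𝐃_k := `tsys d (L·N′)` (M-cubes of π_k,
L·N′ per direction), 𝐃_{k+1} := `tsys d N′` (LM-cubes of π_{k+1}, N′ per direction; p. 13: *"we take cubes from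
π_{k+1}, i.e. cubes of the size LM"*), d_j := `torusTreeLen`; all other fields verbatim those of `B13.StepData`
(configurations, bond variables, V′_k, V_k, Q, V″_k, the activity H(Z), E^{(k+1)}, the log Z^{(k)} terms, the
reader-owned predicates, the restrictions) — cf. `TreeLengthTorusGeometry.TorusStep` (𝐃_{k+1} only) and the window
version `B13Lemma3Window.TwoWindowStep`. [cite: Balaban1988RG2Cluster, (1.1)–(2.13) pp.3–14 (carrier)] -/
structure TwoTorusStep (d L N' : ℕ) [NeZero L] [NeZero N'] where
  volk : (tsys d (L * N')).Dom → ℕ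
  Φ : Type
  Bond : Type
  [finBond : Fintype Bond]
  sp1 : (tsys d (L * N')).Dom → Set Φ
  sp2 : (tsys d N').Dom → Set Φ
  Bv : Φ → Bond → ℂ
  Vp : (tsys d (L * N')).Dom → Φ → ℂ
  V : (tsys d (L * N')).Dom → Φ → ℂ
  Q : (tsys d (L * N')).Dom → Φ → Bond → Bond → ℂ
  Vpp : (tsys d (L * N')).Dom → Φ → ℂ
  H : (tsys d N').Dom → Φ → ℂ
  Ek1 : (tsys d N').Dom → Φ → ℂ
  Elog : (tsys d N').Dom → Φ → ℂ
  Analytic : (Φ → ℂ) → Set Φ → Prop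
  GaugeInv : (Φ → ℂ) → Prop
  Repr17 : Prop
  Restr : Prop

namespace TwoTorusStep

variable {L N' : ℕ} [NeZero L] [NeZero N']

/-- Two-torus step data as (one-)torus step data of `TreeLengthTorusGeometry` (𝐃_k := `tsys d (L·N′)`), so that the
torus closing step `TreeLengthTorusGeometry.deliverables_torus` applies to it. [folklore] -/
def toTorusStep (W : TwoTorusStep d L N') : TorusStep d N' where
  Dk := tsys d (L * N')
  volk := W.volk
  Φ := W.Φ
  Bond := W.Bond
  finBond := W.finBond
  sp1 := W.sp1
  sp2 := W.sp2
  Bv := W.Bv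
  Vp := W.Vp
  V := W.V
  Q := W.Q
  Vpp := W.Vpp
  H := W.H
  Ek1 := W.Ek1
  Elog := W.Elog
  Analytic := W.Analytic
  GaugeInv := W.GaugeInv
  Repr17 := W.Repr17
  Restr := W.Restr

/-- Two-torus step data as abstract step data (`Dk := tsys d (L·N′)`, `Dk1 := tsys d N′`). [folklore] -/
abbrev toStepData (W : TwoTorusStep d L N') : B13.StepData := W.toTorusStep.toStepData

/-- The k-system of two-torus step data is the fine torus system 𝐃_k of the papers' periodic carrier, definitionally. [cite: Balaban1988RG2Cluster, (1.1)–(2.13) pp.3–14 (carrier)] -/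
@[simp] theorem toStepData_Dk (W : TwoTorusStep d L N') : W.toStepData.Dk = tsys d (L * N') := rfl

/-- The (k+1)-system of two-torus step data is the coarse torus system 𝐃_{k+1} (p. 13: *"cubes of the size LM"*), definitionally. [cite: Balaban1988RG2Cluster, (1.1)–(2.13) pp.3–14 (carrier)] -/
@[simp] theorem toStepData_Dk1 (W : TwoTorusStep d L N') : W.toStepData.Dk1 = tsys d N' := rfl

end TwoTorusStep

/-! ## §4. Lemma 3's resummation on the two-torus model with every geometric input discharged -/

section Lemma3

variable {L N' : ℕ} [NeZero L] [NeZero N']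

open Classical in
/-- **Lemma 3's resummation on the two-scale TORUS model: (2.26) ⇒ (2.38)_ℓ with every geometric / combinatorial input
DISCHARGED** (pp. 17–20 [17–20]; p. 17, verbatim: *"To get a bound for H(Z) we have to perform the resummation of the
terms (2.14) over 𝐃, P and Z₀. We do it in the following order. For a fixed Y₀ we sum over all 𝐃 satisfying (2.2).
Next, we sum over Y₀, P determining a fixed Z₀. Further, for a fixed Z′₀, we sum over all possible Z₀ determining this
fixed Z′₀. Finally we sum over all Z′₀ ⊂ Z."*).  For two-torus step data (𝐃_k := `tsys 4 (L·N′)`, 𝐃_{k+1} :=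
`tsys 4 N′`, L = `c.L`, d = 4), a cube side M (the unit torus T₁^{(k)} has M·L·N′ sites per direction) and a transfer
factor ℓ ≥ 0 with (2.36)_ℓ (`B13.Ineq236With … (tclosureDom L N′) ℓ`): IF on the space of p. 15 `‖H(Z)‖ ≤ e^{a₅|Z|}
Σ_{Z′₀ ⊆ Z, Z′₀ ≠ ∅} e^{−(κ₁−1)|Z∖Z′₀|} Π_{torus components Z′_i of Z′₀} famSum_{families of 𝐃_{k+1}-domains covering Z′_i}
Π_{Z′} compSum_{non-empty sets of 𝐃_k-domains with closure Z′} Π innerSum` (the (2.26)-weights `α₆ε₂e^{−(1−3δ)κd_k(Y)}`,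
`e^{−(a/2)|P|}` summed over Y₀ ⊆ Z₀-component, available torus bonds P covering Z₀∖Y₀, covering families 𝐃 of Y₀ —
all index sets CONCRETE ON THE TORUS: `J`, `I`, `wZ`, `cc`, `tclosureDom`, `ttouch`, `tavail`) — `hrep`, the analytic
input (2.15)–(2.26) being by assertion in print — THEN `B13.Bound238With W.toStepData c ℓ`: ‖H(Z)‖ ≤
C₃ε₁e^{−(1−8δ)ℓκd_{k+1}(Z)}, GIVEN ONLY the restrictions on the constants: signs, R15 `c.R15`, R16 as `18(1−4δ)κ ≤ a/20`
(covered by `B13.Consts.R16repaired`) and `4κ ≤ a/20` (a = γ₂ε₁²/g_k²), R17 `e^{−a/20} ≤ ε₂`, (2.31) `8M⁴e^{−a/10} ≤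
a/20`, the (2.29)/(1.26) thresholds at both scales (`κ₀(64,8) + a₂ ≤ δκ`, `α₆e^{a₂}K₀(64,8)·64 ≤ a₂`, likewise at the
rate δℓκ), `64e^{−a/20} ≤ δκ`, R18 `B13Step237.R18half/R18sharp` at A = K₀(64,8)·exp(64e^{−a/20}), R20 as `18(1−7δ)ℓκ ≤
½(κ₁−1)`, R21 as `a₅ + e^{−½(κ₁−1)} ≤ Aabs`, `64·Aabs ≤ δℓκ`, and the absorption `(bracketF/α₆)·e^{64 Aabs} ≤ C₃ε₁`
of the honest constants into the O(1) of C₃.  Discharged inside: `hne`, `htouch`, `havail`, `h229`, `h2732`, `h230`,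
`hvol`, `hanch`, `hLfac`, `h126`, `hcc`, `h227'`, `h229'`, `h232`, `hvol1`, `hw`, `hws` of
`B13Lemma3Assembly.bound238With_of_226`.  Window version `B13Lemma3Window.bound238With_window`.
[cite: Balaban1988RG2Cluster, Lemma 3 (2.38) p.20] -/
theorem bound238With_torus (c : B13.Consts) (hLc : c.L = L) (W : TwoTorusStep 4 L N') (M : ℕ) [NeZero M]
    {ℓ a a₂ a₂' a₅ Aabs : ℝ}
    (hrep : ∀ (Z : TDom 4 N') (φ : W.Φ), φ ∈ W.sp2 Z → ‖W.H Z φ‖ ≤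
      Real.exp (a₅ * ((Z.1).card : ℝ)) *
      ∑ j : J Z, Real.exp (-((c.κ₁ - 1) * ((wZ Z j).card : ℝ))) *
        ∏ i : I Z j, famSum (B13FamilySum.coveringFamilies (Finset.univ : Finset (TDom 4 N'))
            (fun Z' : TDom 4 N' => Z'.1) (cc Z j i))
          (fun Z' => compSum (Finset.univ.filter fun Zc : TDom 4 (L * N') => tclosureDom L N' Zc = Z')
            (fun Zc => innerSum (Finset.univ : Finset (TDom 4 (L * N'))) (fun Y : TDom 4 (L * N') => Y.1)
              (tsys 4 (L * N')).dj Zc.1 (ttouch M (L * N')) (tavail M (L * N') Zc)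
              (c.α₆ * c.eps2) ((1 - 3 * c.δ) * c.κ) a)))
    (h236 : B13.Ineq236With (tsys 4 (L * N')) (tsys 4 N') (tclosureDom L N') ℓ) (hℓ : 0 ≤ ℓ)
    (hα₆ : 0 < c.α₆) (hε₀ : 0 ≤ c.eps2) (hδ : 0 ≤ c.δ) (hδ7 : 0 ≤ 1 - 7 * c.δ) (hκ : 0 ≤ c.κ) (ha : 0 ≤ a)
    (hR15 : c.R15) (hR16 : 18 * ((1 - 4 * c.δ) * c.κ) ≤ a / 20) (hR16' : 4 * c.κ ≤ a / 20)
    (hR17 : Real.exp (-(a / 20)) ≤ c.eps2) (h231 : 2 * (4 : ℝ) * (M : ℝ) ^ 4 * Real.exp (-(a / 10)) ≤ a / 20)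
    (ha₂ : 0 ≤ a₂) (hκ229 : kappa₀ 64 8 + a₂ ≤ c.δ * c.κ)
    (hsm229 : c.α₆ * Real.exp a₂ * K₀ 64 8 * 64 ≤ a₂)
    (habsk : Real.exp (-(a / 20)) * 64 ≤ c.δ * c.κ)
    (h18half : B13Step237.R18half c (K₀ 64 8 * Real.exp (Real.exp (-(a / 20)) * 64)))
    (h18 : B13Step237.R18sharp c (K₀ 64 8 * Real.exp (Real.exp (-(a / 20)) * 64)) ℓ)
    (ha₂' : 0 ≤ a₂') (hκ229' : kappa₀ 64 8 + a₂' ≤ c.δ * ℓ * c.κ)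
    (hsm229' : c.α₆ * Real.exp a₂' * K₀ 64 8 * 64 ≤ a₂')
    (hR20 : 18 * ((1 - 7 * c.δ) * ℓ * c.κ) ≤ (c.κ₁ - 1) / 2)
    (ha₅ : 0 ≤ a₅) (habs : a₅ + Real.exp (-((c.κ₁ - 1) / 2)) ≤ Aabs) (hAc : Aabs * 64 ≤ c.δ * ℓ * c.κ)
    (hC3 : B13Step237.bracketF c (K₀ 64 8 * Real.exp (Real.exp (-(a / 20)) * 64)) / c.α₆ *
      Real.exp (Aabs * 64) ≤ c.C3act * c.ε₁) :
    B13.Bound238With W.toStepData c ℓ := by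
  subst hLc
  have h64 : (4 : ℝ) * 2 ^ 4 = 64 := by norm_num
  have hK : K₀ (4 * 2 ^ 4) (2 * 4) = K₀ 64 8 := by norm_num
  have hκ₀ : kappa₀ (4 * 2 ^ 4) (2 * 4) = kappa₀ 64 8 := by norm_num
  -- scale k (fine torus): volume law, (1.26) at the rate δκ, (2.29)
  have hvol : B13FamilySum.VolBound (Finset.univ : Finset (TDom 4 (c.L * N'))) (fun Y : TDom 4 (c.L * N') => Y.1)
      (tsys 4 (c.L * N')).dj 64 := by
    have h := hvol_torus 4 (c.L * N')
    rwa [h64] at h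
  have h126 : B13FamilySum.Ineq126 (Finset.univ : Finset (TDom 4 (c.L * N'))) (fun Y : TDom 4 (c.L * N') => Y.1)
      (tsys 4 (c.L * N')).dj (c.δ * c.κ) (K₀ 64 8) := by
    have hr : kappa₀ (4 * 2 ^ 4) (2 * 4) ≤ c.δ * c.κ := by rw [hκ₀]; linarith
    have h := h126_torus 4 (c.L * N') hr
    rwa [hK] at h
  have h229 : B13FamilySum.Ineq229 (Finset.univ : Finset (TDom 4 (c.L * N'))) (fun Y : TDom 4 (c.L * N') => Y.1)
      (tsys 4 (c.L * N')).dj c.α₆ (c.δ * c.κ) :=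
    h229_torus 4 (c.L * N') c.δ c.κ c.α₆ a₂ hα₆.le ha₂ (by rw [hκ₀]; exact hκ229) (by rw [hK, h64]; exact hsm229)
  -- scale k + 1 (coarse torus): (2.29) at the rate δℓκ, volume law
  have h229' : B13FamilySum.Ineq229 (Finset.univ : Finset (TDom 4 N')) (fun Y : TDom 4 N' => Y.1)
      (tsys 4 N').dj c.α₆ (c.δ * ℓ * c.κ) :=
    h229_torus 4 N' (c.δ * ℓ) c.κ c.α₆ a₂' hα₆.le ha₂' (by rw [hκ₀]; exact hκ229') (by rw [hK, h64]; exact hsm229')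
  have hvol1 : ∀ Z : TDom 4 N', ((Z.1).card : ℝ) ≤ 64 * (1 + (tsys 4 N').dj Z) := by
    intro Z
    have h := hvol1_torus Z
    rwa [h64] at h
  exact B13Lemma3Assembly.bound238With_of_226 W.toStepData c ℓ
    (Cube := TPt 4 (c.L * N')) (Bond := TBond 4 M (c.L * N')) (α := TPt 4 N')
    (fun Y : TDom 4 (c.L * N') => Y.1) (ttouch M (c.L * N')) (tavail M (c.L * N')) (tclosureDom c.L N')
    (tanchor c.L) (fun Z => J Z) (fun Z j => I Z j) (fun Z j i => dI Z j i) (fun Z : TDom 4 N' => Z.1)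
    (fun Z j => wZ Z j) (fun Z => wZ_injective Z) (fun Z j => wZ_subset Z j)
    (fun Z' : TDom 4 N' => Z'.1) (fun Z j i => cc Z j i)
    (M4 := 2 * (4 : ℝ) * (M : ℝ) ^ 4) (c₃₂ := 18) (c₁ := 64) (K₁ := K₀ 64 8) (c₃₂' := 18) (c₁' := 64)
    hrep hα₆ hε₀ hδ hδ7 hκ hℓ ha (K₀_pos _ _).le
    tdom_nonempty hR15 hR16 hR16' hR17 h231 (card_ttouch_le (M := M) (N := c.L * N'))
    (fun Zc Y₀ _ => by have h := card_tavail_le (M := M) Zc Y₀; push_cast at h ⊢; exact h)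
    h229 (fun Zc Y₀ hY₀ D hD hDne => h2732_torus_four Zc Y₀ hY₀ D hD hDne)
    h230_torus hvol habsk h236 hanch_torus (fun Z' => card_tanchor_le Z') h126 h18half h18
    cc_nonempty h227'_torus h229' (fun Z j => h232_torus_four Z j) hR20 ha₅ habs hvol1 hAc hC3

open Classical in
/-- **(2.38) AS PRINTED on the two-scale TORUS model, from (2.26) and numbers only.**  Lemma 3 p. 20, verbatim:
*"Under all the above restrictions on the constants M, κ, κ₁, α₀, α₁, α₄, α₆, γ₂, γ, ε₁, the activity H(Z) for a
localization domain Z ∈ 𝐃_{k+1} satisfies the inequality |H(Z)| ≦ C₃ε₁ exp(−(1 − 8δ)½Lκd_{k+1}(Z)). (2.38)"*  At the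
printed transfer factor ℓ = ½L with L ≥ 8, (2.36) being the THEOREM
`TreeLengthTorusGeometry236Printed.ineq236Printed_torus` on the papers' periodic carrier: `B13.Bound238 W.toStepData c`
from `hrep` (the (2.26)-majorant over the concrete torus index sets) and the restrictions on the constants (as in
`bound238With_torus`, at ℓ = ½L; R20 reads *"½(κ₁ − 1) ≧ 2Lκ"* up to the constants 18/(1−7δ)).  Window version
`B13Lemma3Window.bound238_window`. [cite: Balaban1988RG2Cluster, Lemma 3 (2.38) p.20] -/
theorem bound238_torus (c : B13.Consts) (hL : 8 ≤ c.L) (hLc : c.L = L) (W : TwoTorusStep 4 L N') (M : ℕ) [NeZero M]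
    {a a₂ a₂' a₅ Aabs : ℝ}
    (hrep : ∀ (Z : TDom 4 N') (φ : W.Φ), φ ∈ W.sp2 Z → ‖W.H Z φ‖ ≤
      Real.exp (a₅ * ((Z.1).card : ℝ)) *
      ∑ j : J Z, Real.exp (-((c.κ₁ - 1) * ((wZ Z j).card : ℝ))) *
        ∏ i : I Z j, famSum (B13FamilySum.coveringFamilies (Finset.univ : Finset (TDom 4 N'))
            (fun Z' : TDom 4 N' => Z'.1) (cc Z j i))
          (fun Z' => compSum (Finset.univ.filter fun Zc : TDom 4 (L * N') => tclosureDom L N' Zc = Z')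
            (fun Zc => innerSum (Finset.univ : Finset (TDom 4 (L * N'))) (fun Y : TDom 4 (L * N') => Y.1)
              (tsys 4 (L * N')).dj Zc.1 (ttouch M (L * N')) (tavail M (L * N') Zc)
              (c.α₆ * c.eps2) ((1 - 3 * c.δ) * c.κ) a)))
    (hα₆ : 0 < c.α₆) (hε₀ : 0 ≤ c.eps2) (hδ : 0 ≤ c.δ) (hδ7 : 0 ≤ 1 - 7 * c.δ) (hκ : 0 ≤ c.κ) (ha : 0 ≤ a)
    (hR15 : c.R15) (hR16 : 18 * ((1 - 4 * c.δ) * c.κ) ≤ a / 20) (hR16' : 4 * c.κ ≤ a / 20)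
    (hR17 : Real.exp (-(a / 20)) ≤ c.eps2) (h231 : 2 * (4 : ℝ) * (M : ℝ) ^ 4 * Real.exp (-(a / 10)) ≤ a / 20)
    (ha₂ : 0 ≤ a₂) (hκ229 : kappa₀ 64 8 + a₂ ≤ c.δ * c.κ)
    (hsm229 : c.α₆ * Real.exp a₂ * K₀ 64 8 * 64 ≤ a₂)
    (habsk : Real.exp (-(a / 20)) * 64 ≤ c.δ * c.κ)
    (h18half : B13Step237.R18half c (K₀ 64 8 * Real.exp (Real.exp (-(a / 20)) * 64)))
    (h18 : B13Step237.R18sharp c (K₀ 64 8 * Real.exp (Real.exp (-(a / 20)) * 64)) ((c.L : ℝ) / 2))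
    (ha₂' : 0 ≤ a₂') (hκ229' : kappa₀ 64 8 + a₂' ≤ c.δ * ((c.L : ℝ) / 2) * c.κ)
    (hsm229' : c.α₆ * Real.exp a₂' * K₀ 64 8 * 64 ≤ a₂')
    (hR20 : 18 * ((1 - 7 * c.δ) * ((c.L : ℝ) / 2) * c.κ) ≤ (c.κ₁ - 1) / 2)
    (ha₅ : 0 ≤ a₅) (habs : a₅ + Real.exp (-((c.κ₁ - 1) / 2)) ≤ Aabs)
    (hAc : Aabs * 64 ≤ c.δ * ((c.L : ℝ) / 2) * c.κ)
    (hC3 : B13Step237.bracketF c (K₀ 64 8 * Real.exp (Real.exp (-(a / 20)) * 64)) / c.α₆ *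
      Real.exp (Aabs * 64) ≤ c.C3act * c.ε₁) :
    B13.Bound238 W.toStepData c := by
  subst hLc
  rw [← B13.bound238With_half]
  have h236 : B13.Ineq236With (tsys 4 (c.L * N')) (tsys 4 N') (tclosureDom c.L N') ((c.L : ℝ) / 2) :=
    ineq236Printed_torus (d := 4) c.L N' (by omega)
  exact bound238With_torus c rfl W M hrep h236 (by positivity) hα₆ hε₀ hδ hδ7 hκ ha hR15 hR16 hR16' hR17 h231 ha₂ hκ229
    hsm229 habsk h18half h18 ha₂' hκ229' hsm229' hR20 ha₅ habs hAc hC3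

/-- Hence the statement row **Lemma 3 AS PRINTED**, `B13.Lemma3Printed W.toStepData c` (:= `Restr → Bound238`), on the
two-scale TORUS model from (2.26) and numbers — the restrictions having been consumed as the explicit numerical
hypotheses of `bound238_torus`. [cite: Balaban1988RG2Cluster, Lemma 3 p.20] -/
theorem lemma3Printed_torus (W : TwoTorusStep 4 L N') (c : B13.Consts) (h : B13.Bound238 W.toStepData c) :
    B13.Lemma3Printed W.toStepData c := fun _ => h

/-- … and with a general transfer factor: `B13.Lemma3With W.toStepData c ℓ` from `B13.Bound238With W.toStepData c ℓ`
(`B13Lemma3Assembly.lemma3With_of_bound238With`) — the form consumed by the torus closing step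
`TreeLengthTorusGeometry.deliverables_torus`. [cite: Balaban1988RG2Cluster, Lemma 3 p.20] -/
theorem lemma3With_torus (W : TwoTorusStep 4 L N') (c : B13.Consts) {ℓ : ℝ} (h : B13.Bound238With W.toStepData c ℓ) :
    B13.Lemma3With W.toStepData c ℓ :=
  B13Lemma3Assembly.lemma3With_of_bound238With W.toStepData c ℓ h

open Classical in
/-- The same at the kernel-certified transfer factor ℓ = L / a236c(L) for every L ≥ 3 ((2.36) in the form
`TreeLengthTorusGeometry236Printed.ineq236With_torus_centre`, a236c(L) = 3/2 + 3/(L − 2); transfer factor 22/3 at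
L = 13): `B13.Bound238With W.toStepData c (L / a236c L)` from `hrep` and the restrictions at that ℓ.  Window version
`B13Lemma3Window.bound238With_window_centre`. [cite: Balaban1988RG2Cluster, (2.36)–(2.38) pp.19–20] -/
theorem bound238With_torus_centre (c : B13.Consts) (hL : 3 ≤ c.L) (hLc : c.L = L) (W : TwoTorusStep 4 L N') (M : ℕ)
    [NeZero M] {a a₂ a₂' a₅ Aabs : ℝ}
    (hrep : ∀ (Z : TDom 4 N') (φ : W.Φ), φ ∈ W.sp2 Z → ‖W.H Z φ‖ ≤
      Real.exp (a₅ * ((Z.1).card : ℝ)) *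
      ∑ j : J Z, Real.exp (-((c.κ₁ - 1) * ((wZ Z j).card : ℝ))) *
        ∏ i : I Z j, famSum (B13FamilySum.coveringFamilies (Finset.univ : Finset (TDom 4 N'))
            (fun Z' : TDom 4 N' => Z'.1) (cc Z j i))
          (fun Z' => compSum (Finset.univ.filter fun Zc : TDom 4 (L * N') => tclosureDom L N' Zc = Z')
            (fun Zc => innerSum (Finset.univ : Finset (TDom 4 (L * N'))) (fun Y : TDom 4 (L * N') => Y.1)
              (tsys 4 (L * N')).dj Zc.1 (ttouch M (L * N')) (tavail M (L * N') Zc)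
              (c.α₆ * c.eps2) ((1 - 3 * c.δ) * c.κ) a)))
    (hα₆ : 0 < c.α₆) (hε₀ : 0 ≤ c.eps2) (hδ : 0 ≤ c.δ) (hδ7 : 0 ≤ 1 - 7 * c.δ) (hκ : 0 ≤ c.κ) (ha : 0 ≤ a)
    (hR15 : c.R15) (hR16 : 18 * ((1 - 4 * c.δ) * c.κ) ≤ a / 20) (hR16' : 4 * c.κ ≤ a / 20)
    (hR17 : Real.exp (-(a / 20)) ≤ c.eps2) (h231 : 2 * (4 : ℝ) * (M : ℝ) ^ 4 * Real.exp (-(a / 10)) ≤ a / 20)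
    (ha₂ : 0 ≤ a₂) (hκ229 : kappa₀ 64 8 + a₂ ≤ c.δ * c.κ)
    (hsm229 : c.α₆ * Real.exp a₂ * K₀ 64 8 * 64 ≤ a₂)
    (habsk : Real.exp (-(a / 20)) * 64 ≤ c.δ * c.κ)
    (h18half : B13Step237.R18half c (K₀ 64 8 * Real.exp (Real.exp (-(a / 20)) * 64)))
    (h18 : B13Step237.R18sharp c (K₀ 64 8 * Real.exp (Real.exp (-(a / 20)) * 64)) ((c.L : ℝ) / a236c c.L))
    (ha₂' : 0 ≤ a₂') (hκ229' : kappa₀ 64 8 + a₂' ≤ c.δ * ((c.L : ℝ) / a236c c.L) * c.κ)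
    (hsm229' : c.α₆ * Real.exp a₂' * K₀ 64 8 * 64 ≤ a₂')
    (hR20 : 18 * ((1 - 7 * c.δ) * ((c.L : ℝ) / a236c c.L) * c.κ) ≤ (c.κ₁ - 1) / 2)
    (ha₅ : 0 ≤ a₅) (habs : a₅ + Real.exp (-((c.κ₁ - 1) / 2)) ≤ Aabs)
    (hAc : Aabs * 64 ≤ c.δ * ((c.L : ℝ) / a236c c.L) * c.κ)
    (hC3 : B13Step237.bracketF c (K₀ 64 8 * Real.exp (Real.exp (-(a / 20)) * 64)) / c.α₆ *
      Real.exp (Aabs * 64) ≤ c.C3act * c.ε₁) :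
    B13.Bound238With W.toStepData c ((c.L : ℝ) / a236c c.L) := by
  subst hLc
  have hL3 : (3 : ℝ) ≤ (c.L : ℝ) := by exact_mod_cast hL
  have hℓ : 0 ≤ (c.L : ℝ) / a236c c.L := div_nonneg (by linarith) (a236c_pos (by linarith)).le
  have h236 : B13.Ineq236With (tsys 4 (c.L * N')) (tsys 4 N') (tclosureDom c.L N') ((c.L : ℝ) / a236c c.L) :=
    ineq236With_torus_centre (d := 4) c.L N' (by omega)
  exact bound238With_torus c rfl W M hrep h236 hℓ hα₆ hε₀ hδ hδ7 hκ ha hR15 hR16 hR16' hR17 h231 ha₂ hκ229 hsm229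
    habsk h18half h18 ha₂' hκ229' hsm229' hR20 ha₅ habs hAc hC3

end Lemma3

/-! ## §5. §2 of the paper end to end on the torus: from the resummed (2.26) to the delivered clauses of Theorem I.3 -/

section Chain

variable {L N' : ℕ} [NeZero L] [NeZero N']

open Classical in
/-- **§2 of the paper END TO END on the two-scale TORUS model, at the printed ℓ = ½L (L ≥ 8): from the resummed
(2.26)-majorant of H(Z) to the delivered clauses of Theorem I.3** (`B13.Deliverables`: (I.1.18) with ½E₀ for E^{(k+1)}
+ log-half, (I.1.7), analyticity, gauge invariance — p. 21, verbatim: *"The inequality (2.41) and the assumptions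
imply the inequality (I.1.18), with ½E₀ instead of E₀, for the terms of the effective action E^{(k+1)} in (I.1.3)."*).
Chain: `bound238_torus` (`hrep` ⇒ Lemma 3 (2.38) AS PRINTED, every resummation / geometric / combinatorial input of
pp. 17–20 a theorem ON THE TORUS) → `B13.Lemma3With … (L/2)` → `TreeLengthTorusGeometry.deliverables_torus_four` (the
[26]-step (2.38) ⇒ (2.41) by the PROVED Kotecký–Preiss engine `B13Resummation` over the CONSTRUCTED torus polymer
geometry `tgeometry`, (1.26)/(2.27)/(2.29) theorems for `torusTreeLen`, the closing bookkeeping p. 21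
`B13.deliverables_of_chainWith_logHalf`).  HYPOTHESES left, all printed inputs stated by assertion or numbers: the
resummed (2.26)-majorant (`hrep`: the analytic content (2.15)–(2.26)); the representation (2.13) of E^{(k+1)}(X) as the
X-localized part of log Ξ over the torus incompatibility `TTouch` (`h213`) and the restriction property of the spaces
p. 15 (`hsp`); the UNPRINTED per-cube log Z^{(k)} leaf (`hlog`, `B13.LogHalfBound`, cell GAPS G-B13-12); (I.1.7) /
analyticity / gauge invariance (`hrepr`, `han`, `hg`); the restrictions `Restr`, R15–R24 and the explicit
smallness/largeness conditions (d = 4 constants 64, 8, 9, K₀(64,8), κ₀ = 64 log 162).  Window version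
`B13Lemma3WindowChain.deliverables_window_of_226` (there with the termwise (2.26)). [cite: Balaban1988RG2Cluster, pp.17–22 (Lemma 3 to Theorem I.3)] -/
theorem deliverables_torus_of_226 (c : B13.Consts) (hL : 8 ≤ c.L) (hLc : c.L = L) (W : TwoTorusStep 4 L N') (M : ℕ)
    [NeZero M] {a a₂ a₂' a₅ Aabs : ℝ}
    (hrep : ∀ (Z : TDom 4 N') (φ : W.Φ), φ ∈ W.sp2 Z → ‖W.H Z φ‖ ≤
      Real.exp (a₅ * ((Z.1).card : ℝ)) *
      ∑ j : J Z, Real.exp (-((c.κ₁ - 1) * ((wZ Z j).card : ℝ))) *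
        ∏ i : I Z j, famSum (B13FamilySum.coveringFamilies (Finset.univ : Finset (TDom 4 N'))
            (fun Z' : TDom 4 N' => Z'.1) (cc Z j i))
          (fun Z' => compSum (Finset.univ.filter fun Zc : TDom 4 (L * N') => tclosureDom L N' Zc = Z')
            (fun Zc => innerSum (Finset.univ : Finset (TDom 4 (L * N'))) (fun Y : TDom 4 (L * N') => Y.1)
              (tsys 4 (L * N')).dj Zc.1 (ttouch M (L * N')) (tavail M (L * N') Zc)
              (c.α₆ * c.eps2) ((1 - 3 * c.δ) * c.κ) a)))
    (hα₆ : 0 < c.α₆) (hε₀ : 0 ≤ c.eps2) (hδ : 0 ≤ c.δ) (hδ7 : 0 ≤ 1 - 7 * c.δ) (hκ : 0 ≤ c.κ) (ha : 0 ≤ a)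
    (hR15 : c.R15) (hR16 : 18 * ((1 - 4 * c.δ) * c.κ) ≤ a / 20) (hR16' : 4 * c.κ ≤ a / 20)
    (hR17 : Real.exp (-(a / 20)) ≤ c.eps2) (h231 : 2 * (4 : ℝ) * (M : ℝ) ^ 4 * Real.exp (-(a / 10)) ≤ a / 20)
    (ha₂ : 0 ≤ a₂) (hκ229 : kappa₀ 64 8 + a₂ ≤ c.δ * c.κ)
    (hsm229 : c.α₆ * Real.exp a₂ * K₀ 64 8 * 64 ≤ a₂)
    (habsk : Real.exp (-(a / 20)) * 64 ≤ c.δ * c.κ)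
    (h18half : B13Step237.R18half c (K₀ 64 8 * Real.exp (Real.exp (-(a / 20)) * 64)))
    (h18 : B13Step237.R18sharp c (K₀ 64 8 * Real.exp (Real.exp (-(a / 20)) * 64)) ((c.L : ℝ) / 2))
    (ha₂' : 0 ≤ a₂') (hκ229' : kappa₀ 64 8 + a₂' ≤ c.δ * ((c.L : ℝ) / 2) * c.κ)
    (hsm229' : c.α₆ * Real.exp a₂' * K₀ 64 8 * 64 ≤ a₂')
    (hR20 : 18 * ((1 - 7 * c.δ) * ((c.L : ℝ) / 2) * c.κ) ≤ (c.κ₁ - 1) / 2)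
    (ha₅ : 0 ≤ a₅) (habs : a₅ + Real.exp (-((c.κ₁ - 1) / 2)) ≤ Aabs)
    (hAc : Aabs * 64 ≤ c.δ * ((c.L : ℝ) / 2) * c.κ)
    (hC3 : B13Step237.bracketF c (K₀ 64 8 * Real.exp (Real.exp (-(a / 20)) * 64)) / c.α₆ *
      Real.exp (Aabs * 64) ≤ c.C3act * c.ε₁)
    (hsp : ∀ X Z : (tsys 4 N').Dom, ∀ φ, Z.1 ⊆ X.1 → φ ∈ W.sp2 X → φ ∈ W.sp2 Z)
    (h213 : ∀ X : (tsys 4 N').Dom, ∀ φ, φ ∈ W.sp2 X →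
      W.Ek1 X φ = locE (TTouch (d := 4) (N := N')) (fun Z : (tsys 4 N').Dom => Z.1) (fun Z => W.H Z φ) X.1)
    (hA : 0 ≤ c.C3act * c.ε₁)
    (hlarge : c.κ + 2 * (64 * Real.log 162) + 2 ≤ (1 - 8 * c.δ) * ((c.L : ℝ) / 2) * c.κ)
    (hsmall : c.C3act * c.ε₁ * Real.exp (5 * c.κ + 1) * K₀ 64 8 * 9 * 64 ≤ 1)
    (hA₂ : Real.exp 1 * 9 * 64 * K₀ 64 8 ^ 2 ≤ c.A₂)
    (hR : W.Restr) (h22 : c.R22) (h23 : c.R23) (h24 : c.R24sharp) (hE₀ : 0 ≤ c.E₀) {Bc : ℝ} (hBc : 0 ≤ Bc)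
    (hlog : B13.LogHalfBound W.toStepData.Dk1 W.toStepData.sp2 W.toStepData.Elog (fun X => X.1.card) Bc (c.δ₀ * c.M))
    (hE₀def : Bc * 64 ≤ c.E₀ / 2) (hrepr : W.Repr17)
    (han : ∀ X, W.Analytic (W.toStepData.Etot X) (W.sp2 X))
    (hg : ∀ X, W.GaugeInv (W.toStepData.Etot X)) :
    B13.Deliverables W.toStepData c := by
  have h238 : B13.Bound238 W.toStepData c :=
    bound238_torus c hL hLc W M hrep hα₆ hε₀ hδ hδ7 hκ ha hR15 hR16 hR16' hR17 h231 ha₂ hκ229 hsm229 habsk h18half h18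
      ha₂' hκ229' hsm229' hR20 ha₅ habs hAc hC3
  have h3 : B13.Lemma3With W.toStepData c ((c.L : ℝ) / 2) := fun _ => (B13.bound238With_half W.toStepData c).2 h238
  exact deliverables_torus_four W.toTorusStep c hsp h213 hA hκ hlarge hsmall hA₂ hR h3
    ((B13.Consts.R22gen_half_iff c).2 h22) h23 h24 hE₀ hBc hlog hE₀def hrepr han hg

open Classical in
/-- The same chain at the kernel-certified transfer factor ℓ = L / a236c(L), every L ≥ 3 (`bound238With_torus_centre` →
`B13.Lemma3With … (L / a236c L)` → `TreeLengthTorusGeometry.deliverables_torus` with the d = 4 constants normalized as in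
`deliverables_torus_four`; the closing choice p. 21 *"we assume that (1 − 10δ)½L = 1"* in the general-ℓ form
`B13.Consts.R22gen (L / a236c L)`).  Window version `B13Lemma3WindowChain.deliverables_window_centre_of_226`.
[cite: Balaban1988RG2Cluster, pp.17–22 (Lemma 3 to Theorem I.3)] -/
theorem deliverables_torus_centre_of_226 (c : B13.Consts) (hL : 3 ≤ c.L) (hLc : c.L = L) (W : TwoTorusStep 4 L N')
    (M : ℕ) [NeZero M] {a a₂ a₂' a₅ Aabs : ℝ}
    (hrep : ∀ (Z : TDom 4 N') (φ : W.Φ), φ ∈ W.sp2 Z → ‖W.H Z φ‖ ≤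
      Real.exp (a₅ * ((Z.1).card : ℝ)) *
      ∑ j : J Z, Real.exp (-((c.κ₁ - 1) * ((wZ Z j).card : ℝ))) *
        ∏ i : I Z j, famSum (B13FamilySum.coveringFamilies (Finset.univ : Finset (TDom 4 N'))
            (fun Z' : TDom 4 N' => Z'.1) (cc Z j i))
          (fun Z' => compSum (Finset.univ.filter fun Zc : TDom 4 (L * N') => tclosureDom L N' Zc = Z')
            (fun Zc => innerSum (Finset.univ : Finset (TDom 4 (L * N'))) (fun Y : TDom 4 (L * N') => Y.1)
              (tsys 4 (L * N')).dj Zc.1 (ttouch M (L * N')) (tavail M (L * N') Zc)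
              (c.α₆ * c.eps2) ((1 - 3 * c.δ) * c.κ) a)))
    (hα₆ : 0 < c.α₆) (hε₀ : 0 ≤ c.eps2) (hδ : 0 ≤ c.δ) (hδ7 : 0 ≤ 1 - 7 * c.δ) (hκ : 0 ≤ c.κ) (ha : 0 ≤ a)
    (hR15 : c.R15) (hR16 : 18 * ((1 - 4 * c.δ) * c.κ) ≤ a / 20) (hR16' : 4 * c.κ ≤ a / 20)
    (hR17 : Real.exp (-(a / 20)) ≤ c.eps2) (h231 : 2 * (4 : ℝ) * (M : ℝ) ^ 4 * Real.exp (-(a / 10)) ≤ a / 20)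
    (ha₂ : 0 ≤ a₂) (hκ229 : kappa₀ 64 8 + a₂ ≤ c.δ * c.κ)
    (hsm229 : c.α₆ * Real.exp a₂ * K₀ 64 8 * 64 ≤ a₂)
    (habsk : Real.exp (-(a / 20)) * 64 ≤ c.δ * c.κ)
    (h18half : B13Step237.R18half c (K₀ 64 8 * Real.exp (Real.exp (-(a / 20)) * 64)))
    (h18 : B13Step237.R18sharp c (K₀ 64 8 * Real.exp (Real.exp (-(a / 20)) * 64)) ((c.L : ℝ) / a236c c.L))
    (ha₂' : 0 ≤ a₂') (hκ229' : kappa₀ 64 8 + a₂' ≤ c.δ * ((c.L : ℝ) / a236c c.L) * c.κ)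
    (hsm229' : c.α₆ * Real.exp a₂' * K₀ 64 8 * 64 ≤ a₂')
    (hR20 : 18 * ((1 - 7 * c.δ) * ((c.L : ℝ) / a236c c.L) * c.κ) ≤ (c.κ₁ - 1) / 2)
    (ha₅ : 0 ≤ a₅) (habs : a₅ + Real.exp (-((c.κ₁ - 1) / 2)) ≤ Aabs)
    (hAc : Aabs * 64 ≤ c.δ * ((c.L : ℝ) / a236c c.L) * c.κ)
    (hC3 : B13Step237.bracketF c (K₀ 64 8 * Real.exp (Real.exp (-(a / 20)) * 64)) / c.α₆ *
      Real.exp (Aabs * 64) ≤ c.C3act * c.ε₁)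
    (hsp : ∀ X Z : (tsys 4 N').Dom, ∀ φ, Z.1 ⊆ X.1 → φ ∈ W.sp2 X → φ ∈ W.sp2 Z)
    (h213 : ∀ X : (tsys 4 N').Dom, ∀ φ, φ ∈ W.sp2 X →
      W.Ek1 X φ = locE (TTouch (d := 4) (N := N')) (fun Z : (tsys 4 N').Dom => Z.1) (fun Z => W.H Z φ) X.1)
    (hA : 0 ≤ c.C3act * c.ε₁)
    (hlarge : c.κ + 2 * (64 * Real.log 162) + 2 ≤ (1 - 8 * c.δ) * ((c.L : ℝ) / a236c c.L) * c.κ)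
    (hsmall : c.C3act * c.ε₁ * Real.exp (5 * c.κ + 1) * K₀ 64 8 * 9 * 64 ≤ 1)
    (hA₂ : Real.exp 1 * 9 * 64 * K₀ 64 8 ^ 2 ≤ c.A₂)
    (hR : W.Restr) (h22 : c.R22gen ((c.L : ℝ) / a236c c.L)) (h23 : c.R23) (h24 : c.R24sharp) (hE₀ : 0 ≤ c.E₀)
    {Bc : ℝ} (hBc : 0 ≤ Bc)
    (hlog : B13.LogHalfBound W.toStepData.Dk1 W.toStepData.sp2 W.toStepData.Elog (fun X => X.1.card) Bc (c.δ₀ * c.M))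
    (hE₀def : Bc * 64 ≤ c.E₀ / 2) (hrepr : W.Repr17)
    (han : ∀ X, W.Analytic (W.toStepData.Etot X) (W.sp2 X))
    (hg : ∀ X, W.GaugeInv (W.toStepData.Etot X)) :
    B13.Deliverables W.toStepData c := by
  have h238 := bound238With_torus_centre c hL hLc W M hrep hα₆ hε₀ hδ hδ7 hκ ha hR15 hR16 hR16' hR17 h231 ha₂ hκ229
    hsm229 habsk h18half h18 ha₂' hκ229' hsm229' hR20 ha₅ habs hAc hC3
  have h3 : B13.Lemma3With W.toStepData c ((c.L : ℝ) / a236c c.L) := fun _ => h238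
  exact deliverables_torus_four W.toTorusStep c hsp h213 hA hκ hlarge hsmall hA₂ hR h3 h22 h23 h24 hE₀ hBc hlog hE₀def
    hrepr han hg

end Chain

end Literature.MathematicalPhysics.QuantumFieldTheory.Balaban1983to89.B13Lemma3Torus

end
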